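import Literature.MathematicalPhysics.QuantumFieldTheory.Balaban1983to89.B13TermDatum214ParamHolo

/-!
# `Balaban1983to89.B13TermDatum214CouplingHolo` — T. Bałaban, *Renormalization group approach to lattice gauge field theories. II.
Cluster expansions*, Commun. Math. Phys. **116** (1988) 1–22 [Balaban1988RG2Cluster], (2.14) p. 15 with (2.20) p. 16, (2.26) p. 17, and [Balaban1987RG1]
p. 263 «a C^∞-function of g_{j−1} ∈ [0, γ], (or analytic)»: THE (2.14) TERM OF THE W1 TERM DATUM ALONG THE COMPLEX LAST COUPLING — holomorphic with the (2.26)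
weight on an open set of couplings on which the characteristic functions do not move, from ONE record of located inputs (module 37's transport, along the COUPLING)

statement-level skeleton of published theorems with citation tags; proofs where landed; nothing here is a claim about the
Yang–Mills mass gap

CITATION HEADER (verbatim).  [II] p. 15 [PDF 15], (2.14): the term's last line `(−1)^{|P|} χ_{k,Y₀} χᶜ_{k,P} exp[Σ_{Y∈𝐃} τ(Y)𝐕_k(Y, B)]` — the coupling `g_k`
enters through the characteristic functions of (2.3) p. 12 and through the potentials `𝐕_k` of (1.41) p. 11; p. 16 [PDF 16], (2.20); p. 17 [PDF 17], (2.26).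
[I] = [Balaban1987RG1] p. 263 [PDF 15]: `E^{(j)}(X, g_{j−1}, 𝐔, 𝐉)` «is a C^∞-function of g_{j−1} ∈ [0, γ], (or analytic)».

WHY (cell `pub-ymgap`, Track A node N10 [B13] → N22, seat `pub-ymgap-dag-n10-c` g20; count-neutral).  After the Summit-side module 109B
(`YMDAG.N10.lastCouplingSectors_termData_of_termSectors`, consumed by the N22 junction of record J79) the last-coupling side of N22's ROAD-2 bill at def-W1's
term data is PER TERM: (TS-holo) `z ↦ (𝔇 K k).TF Z t z old φ` holomorphic on an open `O ⊆ ℂ` of couplings and (TS-226) `‖(𝔇 K k).TF Z t z old φ‖ ≤ weight·e^{a₅|Z|}`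
there (+ a centred pair (TS-226₀)∕(TS-centred), not treated here).  In def-W1's datum the coupling `s` enters the (2.14) term ONLY through the last line
`lastLine Z t s old φ = F214 |P| (chiY₀ Z t s) (chicP Z t s) 𝐃 (𝒱 Z t s old φ)` (`TF_apply`, `rfl`); the characteristic functions are REAL-valued at every `s`, so the
honest holomorphic reading keeps them FIXED on `O` (print: the thresholds of (2.3) are the real step's) and lets `s` move through Lemma 2's potentials.  THIS FILE =
module 37 `B13TermDatum214ParamHolo` read ALONG THE COUPLING instead of along the history:
* §1 `primitiveInputs226Holo_of_coupling` — a record of located inputs at `(s₀, old)` TRANSPORTS to the coupling `z` when `chiY₀ Z t z = chiY₀ Z t s₀`,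
  `chicP Z t z = chicP Z t s₀` and the potentials at `z` are measurable and obey (2.20) with the record's letters on the record's τ-region;
* §2 ★ `differentiableOn_TF_coupling_of_inputs226Holo` — (TS-holo): one record `ι` at `(s₀, old)`, an open `O` on which the characteristic functions do not move
  (`hχ`), the potentials `z ↦ 𝒱 Z t z old φ Y B` complex differentiable on `O` (`hVd`), measurable (`hVm`) and (2.20) with `ι`'s letters uniformly on `O` (`h220O`) ⟹
  `z ↦ 𝔇.TF Z t z old φ` is complex differentiable on `O` — module 36's engine `differentiableOn_term214_torus_of_primitives_holo_polyτ` with the potential family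
  `V z := 𝒱 Z t z old φ` and the characteristic functions at `s₀`, then `TF_apply` + `hχ` (`DifferentiableOn.congr`);
* §3 ★ `termCouplingSector_of_inputs226Holo` — BOTH ROWS (TS-holo) ∧ (TS-226) on `O` (§2 + the (2.26) socket `norm_TF_le_weight_of_inputs226Holo` through §1 at each `z`)
  = the per-term binders `hTh` ∧ `hT226` of module 109B ∕ J79 for this term.
What a consumer still supplies (displayed, def-W1's dictionary — NOT asserted here): `hχ` (coupling-free characteristic functions on the sector), `hVd`∕`hVm`∕`h220O`
(Lemma 2's potentials along the complex coupling: under print's law (1.41) a finite linear combination of the older terms with coupling-dependent coefficients),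
and the record `ι` (NODE A's letters).  The centred pair (TS-226₀)∕(TS-centred) needs the parity structure of [II] (2.15) (this lane's `B13Term214Centred` ∕
`B13Bound226Centred`) and is NOT produced here.

HONEST FRAMING.  Count-neutral kernel bookkeeping: one structure transport, one application of module 36's engine, one `congr`; the datum is DATA, the record and the
dictionary rows are HYPOTHESES; nothing of Bałaban's asserted or constructed; nodes N10 ∕ N22 NOT discharged; K-items untouched; one finite 𝕋⁴ programme at fixed
ε — NOT continuum, NOT infinite volume, NOT OS, NOT mass gap, NOT Clay.  0 sorry, 0 `def`, standard axioms.

A6 NOTE (v1.0.1, 2026-08-29, after dag-n22-c g20's LOCATED finding and its certificate `Summits/…/BalabanUVNodesN22TermDataCouplingDictionaryRigidity.lean`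
(p686440 ✓ bb5255ca9440: `chiU_couplingBlind_of_frozenChi_law`, `false_of_frozenChi_law_of_genuineBox`)).  These lemmas are TRUE but are NOT the producer of record
for the last-coupling rows of the N22 bills: under def-W1's unscaled-field law `TermDatum214.UnscaledFieldLawOn` (the `hlaw` row of every term-data bill) the boxes
MOVE with the real coupling (`chiY₀ Z t ↑s B = χᵘ Z t (s • B)`, [Balaban1987RG1] p. 267 «B = g_kB′»), so the dictionary row `hχ` on an open set containing two real
window couplings forces COUPLING-BLIND unscaled boxes — degenerate for genuine boxes.  The honest carrier of the complex last coupling is def-W1's CONTINUED TERM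
FAMILY `TermDatum214.continuedTF` (the window-dilated member read from a base point; `continuedTF_ofReal_eq_TF` under the law), whose member letters on
`ball 1 ρ_b` are produced Summit-side from located primitives by the N22 lane's `…N22W1RelCentredMembersOfDatum*` files over this lane's `B13Term214WindowDilated` ∕
`B13Bound226Centred` engines.  Use this file only where the characteristic functions are genuinely coupling-free on the open set at hand.
-/

noncomputable section

namespace Literature.MathematicalPhysics.QuantumFieldTheory.Balaban1983to89.B13TermDatum214CouplingHolo

open Metric Set Matrix
open scoped BigOperators
open Literature.MathematicalPhysics.QuantumFieldTheory.Balaban1983to89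
open Step B14.Eq213MaximalDomains TreeLengthTorus T4Continuum
open Literature.MathematicalPhysics.QuantumFieldTheory.Balaban1983to89.Node00.Sect2
open Literature.MathematicalPhysics.QuantumFieldTheory.Balaban1983to89.Node00.W1
open Literature.MathematicalPhysics.QuantumFieldTheory.Balaban1983to89.B13Lemma3TorusTerms (weight)
open Literature.MathematicalPhysics.QuantumFieldTheory.Balaban1983to89.B13Term214ParamHolo
  (differentiableOn_term214_torus_of_primitives_holo_polyτ)

variable {c₀ : B13.Consts} {P : Params} {𝔸 : Type*} {M k L : ℕ} [NeZero L] (𝔇 : TermDatum214 c₀ P 𝔸 M k L)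

/-! ## §1  The located (2.26) inputs transport along the coupling when the characteristic functions do not move -/

/-- **THE LOCATED (2.26) INPUTS TRANSPORT ALONG THE COUPLING**: a record at `(s₀, old)`, equality of the characteristic functions at `z` and at `s₀`, and the
measurability and (2.20) bound (record's letters, record's τ-region) of the potentials at the coupling `z` give the located inputs at `(z, old)` — every other
field of `Inputs226Holo` is coupling-free. [cite: Balaban1988RG2Cluster, (2.14) p.15, (2.20) p.16, (2.22) p.16, (2.3) p.12] -/
theorem primitiveInputs226Holo_of_coupling {c : B13.Consts} {Z : (domSys P M (k + 1)).Dom} {t : TermLabel P M k L} {s₀ z : ℂ}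
    {old : OlderTerms P 𝔸 M k} {φ : CPair P 𝔸} {a a₅ : ℝ} (ι : 𝔇.Inputs226Holo c Z t s₀ old φ a a₅)
    (hχ : 𝔇.chiY₀ Z t z = 𝔇.chiY₀ Z t s₀) (hχc : 𝔇.chicP Z t z = 𝔇.chicP Z t s₀)
    (hVm : ∀ Y, Measurable (𝔇.𝒱 Z t z old φ Y))
    (h220U : ∀ τ : TDom P.d (L * domCount P M (k + 1)) → ℂ, (∀ Y, τ Y ∈ ι.Uτ Y) →
      ∀ B, ∑ Y ∈ t.1, ‖τ Y‖ * ‖𝔇.𝒱 Z t z old φ Y B‖ ≤ ι.a₂₀ / 2 * (B ⬝ᵥ B) + ι.w) :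
    𝔇.PrimitiveInputs226Holo c Z t z old φ a a₅ :=
  ⟨{ ι with
      hχ0 := fun B => by rw [hχ]; exact ι.hχ0 B
      hχc0 := fun B => by rw [hχc]; exact ι.hχc0 B
      hχm := by rw [hχ]; exact ι.hχm
      hχcm := by rw [hχc]; exact ι.hχcm
      hVm := hVm
      h222 := fun B => by rw [hχ, hχc]; exact ι.h222 B
      h220U := h220U }⟩

/-! ## §2  (TS-holo): the (2.14) term is holomorphic along the complex coupling on a sector where the characteristic functions do not move -/

/-- ★ **THE (2.14) TERM OF THE DATUM IS HOLOMORPHIC ALONG THE COMPLEX LAST COUPLING** on an open `O ⊆ ℂ` on which the characteristic functions do not move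
(`hχ`), given ONE record `ι` of located inputs at `(s₀, old)` and Lemma 2's potentials along the coupling complex differentiable on `O` (`hVd`), measurable (`hVm`)
and obeying (2.20) with `ι`'s letters on `ι`'s τ-region uniformly on `O` (`h220O`) — module 36's engine with the potential family `z ↦ 𝒱 Z t z old φ` and the
characteristic functions at `s₀`, then `TF_apply` and `hχ`.  No estimate is proved here.
[cite: Balaban1988RG2Cluster, (2.14)–(2.15) p.15, (2.16)–(2.22) p.16, (2.23)–(2.26) p.17; Balaban1987RG1, p.263] -/
theorem differentiableOn_TF_coupling_of_inputs226Holo {c : B13.Consts} {Z : (domSys P M (k + 1)).Dom} {t : TermLabel P M k L} {s₀ : ℂ}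
    {old : OlderTerms P 𝔸 M k} {φ : CPair P 𝔸} {a a₅ : ℝ} (ι : 𝔇.Inputs226Holo c Z t s₀ old φ a a₅)
    {O : Set ℂ} (hO : IsOpen O) (hχ : ∀ z ∈ O, 𝔇.chiY₀ Z t z = 𝔇.chiY₀ Z t s₀ ∧ 𝔇.chicP Z t z = 𝔇.chicP Z t s₀)
    (hVm : ∀ z ∈ O, ∀ Y, Measurable (𝔇.𝒱 Z t z old φ Y))
    (hVd : ∀ Y B, DifferentiableOn ℂ (fun z => 𝔇.𝒱 Z t z old φ Y B) O)
    (h220O : ∀ z ∈ O, ∀ τ : TDom P.d (L * domCount P M (k + 1)) → ℂ, (∀ Y, τ Y ∈ ι.Uτ Y) →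
      ∀ B, ∑ Y ∈ t.1, ‖τ Y‖ * ‖𝔇.𝒱 Z t z old φ Y B‖ ≤ ι.a₂₀ / 2 * (B ⬝ᵥ B) + ι.w) :
    DifferentiableOn ℂ (fun z => 𝔇.TF Z t z old φ) O := by
  have h := differentiableOn_term214_torus_of_primitives_holo_polyτ c hO ι.hUσ ι.hUτ ι.hUexp ι.hr ι.hr' ι.hsubτ
    (sigmaList_spec Z t).1 (tauList_spec t).1 (𝔇.A Z t φ) (𝔇.Gam Z t φ) t.2.card (𝔇.chiY₀ Z t s₀) (𝔇.chicP Z t s₀)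
    ι.hχ0 ι.hχc0 t.1 (fun z => 𝔇.𝒱 Z t z old φ) (𝔇.𝒦 Z t).hC (𝔇.𝒦 Z t).Γ₀ ι.hAhol ι.hχm ι.hχcm hVm hVd ι.hAs ι.hA
    (fun σ => (𝔇.𝒦 Z t).G2 σ (𝔇.uOf Z t φ)) ι.hGhol (fun _ _ _ => rfl) ι.qP ι.h222 ι.hγ₂ ι.hqP ι.ha0 h220O
    (𝔇.𝒦 Z t).locΛ (𝔇.𝒦 Z t).locN (𝔇.𝒦 Z t).hfib ι.hfibN ι.hkap'' ι.h1 ι.h2 ι.hθE ι.hθΓ ι.hθC ι.hKG ι.hKΓ ι.hKCs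
    ι.hK₀ ι.hθEle ι.hθΓle ι.hθR1le ι.hG ι.hΓ₀ ι.hCs ι.hC216 ι.hdΓ ι.hdC ι.hdE ι.hsmallKθ ι.hc0 ι.hc ι.hαc ι.hΓq
    ι.hsmall
  refine h.congr fun z hz => ?_
  rw [TermDatum214.TF_apply, (hχ z hz).1, (hχ z hz).2]

/-! ## §3  Both per-term coupling rows (TS-holo) ∧ (TS-226) from one record -/

/-- ★ **THE PER-TERM COUPLING ROWS (TS-holo) ∧ (TS-226) OF THE SUMMIT-SIDE MODULE 109B, FROM ONE RECORD OF LOCATED INPUTS**: under the data of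
`differentiableOn_TF_coupling_of_inputs226Holo` and the two global numerals `1 ≤ κ₁`, `α₆ ≠ 0`, `z ↦ 𝔇.TF Z t z old φ` is complex differentiable on `O` AND
`‖𝔇.TF Z t z old φ‖ ≤ weight L M c Z a t · exp(a₅|Z|)` for every `z ∈ O` (§2; the weight by node00-def-W1's socket `norm_TF_le_weight_of_inputs226Holo` through the
transport §1 at each `z`) — the binders `hTh` ∧ `hT226` of `YMDAG.N10.lastCouplingSectors_termData_of_termSectors` for this term.
[cite: Balaban1988RG2Cluster, (2.14) p.15, (2.20) p.16, (2.26) p.17; Balaban1987RG1, p.263] -/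
theorem termCouplingSector_of_inputs226Holo {c : B13.Consts} (hκ₁ : 1 ≤ c.κ₁) (hα₆ : c.α₆ ≠ 0) {Z : (domSys P M (k + 1)).Dom}
    {t : TermLabel P M k L} {s₀ : ℂ} {old : OlderTerms P 𝔸 M k} {φ : CPair P 𝔸} {a a₅ : ℝ} (ι : 𝔇.Inputs226Holo c Z t s₀ old φ a a₅)
    {O : Set ℂ} (hO : IsOpen O) (hχ : ∀ z ∈ O, 𝔇.chiY₀ Z t z = 𝔇.chiY₀ Z t s₀ ∧ 𝔇.chicP Z t z = 𝔇.chicP Z t s₀)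
    (hVm : ∀ z ∈ O, ∀ Y, Measurable (𝔇.𝒱 Z t z old φ Y))
    (hVd : ∀ Y B, DifferentiableOn ℂ (fun z => 𝔇.𝒱 Z t z old φ Y B) O)
    (h220O : ∀ z ∈ O, ∀ τ : TDom P.d (L * domCount P M (k + 1)) → ℂ, (∀ Y, τ Y ∈ ι.Uτ Y) →
      ∀ B, ∑ Y ∈ t.1, ‖τ Y‖ * ‖𝔇.𝒱 Z t z old φ Y B‖ ≤ ι.a₂₀ / 2 * (B ⬝ᵥ B) + ι.w) :
    DifferentiableOn ℂ (fun z => 𝔇.TF Z t z old φ) O ∧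
      ∀ z ∈ O, ‖𝔇.TF Z t z old φ‖ ≤ weight L M c Z a t * Real.exp (a₅ * ((Z.1).card : ℝ)) :=
  ⟨differentiableOn_TF_coupling_of_inputs226Holo 𝔇 ι hO hχ hVm hVd h220O, fun z hz =>
    TermDatum214.norm_TF_le_weight_of_inputs226Holo hκ₁ hα₆
      (primitiveInputs226Holo_of_coupling 𝔇 ι (hχ z hz).1 (hχ z hz).2 (hVm z hz) (h220O z hz))⟩

end Literature.MathematicalPhysics.QuantumFieldTheory.Balaban1983to89.B13TermDatum214CouplingHolo

end
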